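import Summits.CriticalPhenomena.PercolationContinuityZ3.Theorems.PercNearOneGluingNoHeavyQuantGatedShiftOneLayer
import Summits.CriticalPhenomena.PercolationContinuityZ3.Theorems.PercNearOneGluingNoHeavyQuantGatedConvCone
import HarnessLib

/-!
# QUANT lane R8, T-DEC: CONJECTURE R (`LawDec.GatedShiftDEC`) IS A THEOREM — the gated shift of an SDEC law is SDEC, for EVERY
# top-affordable law (the relay case of the gate interaction; typed by typer g25 in `…QuantGatedConvCone`)

builds on p205010 (kernel theorem, internal audit signed; external expert review pending)

Support file (`--supports stmt-CriticalPhenomena-4575`), QUANT lane typer seat prim-quant-stmt (gen 26), rung R8 of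
`run/shared/lean/prim/quant/LADDER.md`.  Theorems only, standard axioms, no sorries.  The work is the one-layer gated-shift theorem
`LawDec.flowAtT_gatedShift_succ` (`…QuantGatedShiftOneLayer`, parts 1–3); this file is the bookkeeping: flows ⟷ DEC
(`decAtT_iff_flowAtT`, typer g22), the layer `0` (criterion E), and the induction on the number of sure relays.

* `LawDec.decAt_gatedShift_succ` — ONE LAYER, DEC form: `gate μ q` DEC(J) at floor `q·x` ⟹ `gate (μ(· − 1)) q` DEC(J+1) at floor `q·x`,
  for every probability law `μ` on `{0..M}` with `x·M ≤ mean μ` (`0 < x ≤ 1`, `0 < q ≤ 1`, `q·x < 1`, `J < M`).  No hypothesis at any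
  other layer and no condition on the support (typer g25's `…GatedShiftSubMean` needed "no atom strictly between mean and top";
  lead g24's candidate GatedShiftDEC-WEAK asked for DEC at every layer).
* `LawDec.gatedShift_sdecUpTo_one` / `LawDec.gatedShift_sdecUpTo` — `SDECUpTo x Q M μ ⟹ SDECUpTo x Q (k + M) (μ(· − k))`, `k ≥ 1`.
* **`LawDec.gatedShiftDEC_holds : GatedShiftDEC`** — Conjecture R.  With typer g25's `…QuantGatedConvReduction` /`…QuantGatedConvCone`
  this is the case `μ₁ = δ_k` of Conjecture E (`GatedConvEmptyFree`), which remains OPEN in general, as do `ConvClosedT`,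
  `SDECConvClosed`, `TreeBuiltDEC`, `TreeDEC`, `FarTreeRow`.
TREE READING.  A root vertex with gate `q` carrying `k ≥ 1` sure relays above a forest whose reached-relay count is SDEC is itself SDEC:
hub relays never spoil the decomposition property, at any layer, whatever the forest.

[this work]; flow normal form: this lane (typer g22, lead g21, typer g25).  The gluing rows served [cite: KozmaNitzan2024, Conjecture 3 (p. 15)];
product measure [cite: Grimmett1999, §1.3 p. 10].
-/

noncomputable section

namespace Summit.CriticalPhenomena.PercolationContinuityZ3.Theorems

namespace Quant

open Finset

namespace LawDec

/-! ### The shifted law -/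

/-- law facts of the shifted law `μ(· − k)`: nonnegative, zero above `k + M`, mass `1`, mean `mean μ + k`. [this work] -/
theorem shift_laws (k M : ℕ) (μ : ℕ → ℝ) (hμ0 : ∀ h, 0 ≤ μ h) (hμM : ∀ h, M < h → μ h = 0)
    (hμ1 : ∑ h ∈ Finset.range (M + 1), μ h = 1) :
    (∀ t, 0 ≤ (fun t => if k ≤ t then μ (t - k) else 0) t) ∧
      (∀ t, k + M < t → (fun t => if k ≤ t then μ (t - k) else 0) t = 0) ∧
      (∑ t ∈ Finset.range (k + M + 1), (fun t => if k ≤ t then μ (t - k) else 0) t = 1) ∧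
      (∑ t ∈ Finset.range (k + M + 1), (t : ℝ) * (fun t => if k ≤ t then μ (t - k) else 0) t
        = ∑ h ∈ Finset.range (M + 1), (h : ℝ) * μ h + k) := by
  have reindex : ∀ g : ℕ → ℝ, ∑ t ∈ Finset.range (k + M + 1), (if k ≤ t then g (t - k) else 0)
      = ∑ h ∈ Finset.range (M + 1), g h := by
    intro g
    rw [show k + M + 1 = k + (M + 1) by omega, Finset.sum_range_add]
    rw [Finset.sum_eq_zero (fun t ht => if_neg (by have := Finset.mem_range.1 ht; omega)), zero_add]
    exact Finset.sum_congr rfl fun h _ => by rw [if_pos (by omega), Nat.add_sub_cancel_left]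
  refine ⟨fun t => ?_, fun t ht => ?_, by beta_reduce; rw [reindex, hμ1], ?_⟩
  · beta_reduce; split_ifs; exacts [hμ0 _, le_rfl]
  · beta_reduce; rw [if_pos (by omega)]; exact hμM _ (by omega)
  · have e : ∀ t : ℕ, (t : ℝ) * (fun t => if k ≤ t then μ (t - k) else 0) t
        = (if k ≤ t then (((t - k : ℕ) : ℝ) + k) * μ (t - k) else 0) := by
      intro t; beta_reduce
      split_ifs with hkt
      · rw [show ((t - k : ℕ) : ℝ) + k = t by push_cast [Nat.cast_sub hkt]; ring]
      · rw [mul_zero]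
    simp_rw [e]
    rw [reindex (fun h => ((h : ℝ) + k) * μ h)]
    simp only [add_mul]
    rw [Finset.sum_add_distrib, ← Finset.mul_sum, hμ1, mul_one]

/-! ### One layer, DEC form -/

/-- **ONE LAYER, DEC FORM.**  `0 < x ≤ 1`, `0 < q ≤ 1`, `q·x < 1`; `μ ≥ 0` on `{0..M}`, mass `1`, `x·M ≤ mean μ`; `J < M`.  If `gate μ q` is
DEC(J) at floor `q·x` then `gate (μ(· − 1)) q` is DEC(J+1) at floor `q·x` (`flowAtT_gatedShift_succ` between the two flow normal forms).
[this work] -/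
theorem decAt_gatedShift_succ (x q : ℝ) (J M : ℕ) (μ : ℕ → ℝ) (hx0 : 0 < x) (hx1 : x ≤ 1) (hq0 : 0 < q) (hq1 : q ≤ 1)
    (hqx : q * x < 1) (hμ0 : ∀ h, 0 ≤ μ h) (hμM : ∀ h, M < h → μ h = 0) (hμ1 : ∑ h ∈ Finset.range (M + 1), μ h = 1)
    (hta : x * (M : ℝ) ≤ ∑ h ∈ Finset.range (M + 1), (h : ℝ) * μ h) (hJM : J < M)
    (h : DECAt (q * x) J M (gate μ q)) :
    DECAt (q * x) (J + 1) (M + 1) (gate (fun t => if 1 ≤ t then μ (t - 1) else 0) q) := by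
  set T : ℝ := ∑ h ∈ Finset.range (M + 1), (h : ℝ) * μ h with hT
  set y : ℝ := q * x with hy
  have hy0 : 0 < y := mul_pos hq0 hx0
  have hyq : y ≤ q := mul_le_of_le_one_right hq0.le hx1
  have hta' : y * (M : ℝ) ≤ q * T := by
    rw [hy, mul_assoc]; exact mul_le_mul_of_nonneg_left hta hq0.le
  obtain ⟨_, LM, L1, Lmean, -, -⟩ := gate_shift_laws q M μ (fun t => if 1 ≤ t then μ (t - 1) else 0) hq0.le hq1 hμ0 hμM hμ1
    (fun t => rfl)
  obtain ⟨_, nM, n1⟩ := gate_laws M μ q hq0.le hq1 hμ0 hμM hμ1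
  have nmean : ∑ t ∈ Finset.range (M + 1), (t : ℝ) * gate μ q t = q * T := by rw [sum_mul_gate]
  rw [decAt_iff_decAtT, nmean] at h
  have hF := flowAtT_gatedShift_succ y (q * T) q J M μ hy0 hqx hq0 hq1 hyq hμ0 hμM hμ1 rfl hta' hJM
    ((decAtT_iff_flowAtT y (q * T) J M _ hy0 hqx nM n1).1 h)
  rw [decAt_iff_decAtT, Lmean, show q * (T + 1) = q * T + q by ring]
  exact (decAtT_iff_flowAtT y (q * T + q) (J + 1) (M + 1) _ hy0 hqx LM L1).2 hF

/-! ### Conjecture R -/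

/-- **one sure relay**: `SDECUpTo x Q M μ ⟹ SDECUpTo x Q (M + 1) (μ(· − 1))` for a top-affordable probability law `μ` (`0 < x ≤ 1`,
`Q ≤ 1`, `Q·x < 1`).  Layer `0`: criterion E (`y·(1−q) ≤ q·(1−y)` as `y ≤ q`); layers `≥ 1`: `decAt_gatedShift_succ`. [this work] -/
theorem gatedShift_sdecUpTo_one (x Q : ℝ) (M : ℕ) (μ : ℕ → ℝ) (hx0 : 0 < x) (hx1 : x ≤ 1) (hQ1 : Q ≤ 1)
    (hQx : Q * x < 1) (hμ0 : ∀ h, 0 ≤ μ h) (hμM : ∀ h, M < h → μ h = 0) (hμ1 : ∑ h ∈ Finset.range (M + 1), μ h = 1)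
    (hta : x * (M : ℝ) ≤ ∑ h ∈ Finset.range (M + 1), (h : ℝ) * μ h) (hS : SDECUpTo x Q M μ) :
    SDECUpTo x Q (M + 1) (fun t => if 1 ≤ t then μ (t - 1) else 0) := by
  intro q hq0 hqQ j hj
  set y : ℝ := q * x with hy
  have hq1 : q ≤ 1 := hqQ.trans hQ1
  have hy0 : 0 < y := mul_pos hq0 hx0
  have hy1 : y < 1 := lt_of_le_of_lt (mul_le_mul_of_nonneg_right hqQ hx0.le) hQx
  have hyq : y ≤ q := mul_le_of_le_one_right hq0.le hx1
  by_cases hj0 : j = 0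
  · -- layer 0: the gate-zero rides the giants
    subst hj0
    obtain ⟨L0, LM, L1, -, hL00, -⟩ := gate_shift_laws q M μ (fun t => if 1 ≤ t then μ (t - 1) else 0) hq0.le hq1 hμ0 hμM hμ1
      (fun t => rfl)
    refine decAt_of_giantsAbsorbLows y 0 (M + 1) _ hj L0 LM L1 hy0 ?_
    have hlows : ∑ h ∈ Finset.range (0 + 1),
        (if 2 * (h : ℝ) < ∑ k ∈ Finset.range (M + 1 + 1), (k : ℝ) * gate (fun t => if 1 ≤ t then μ (t - 1) else 0) q k
          then gate (fun t => if 1 ≤ t then μ (t - 1) else 0) q h else 0) ≤ 1 - q := by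
      rw [zero_add, Finset.sum_range_one]
      split_ifs
      · exact le_of_eq hL00
      · linarith
    have hgiants : ∑ h ∈ Finset.Ico (0 + 1) (M + 1 + 1), gate (fun t => if 1 ≤ t then μ (t - 1) else 0) q h = q := by
      have := Finset.sum_range_add_sum_Ico (gate (fun t => if 1 ≤ t then μ (t - 1) else 0) q)
        (show 0 + 1 ≤ M + 1 + 1 by omega)
      rw [L1, zero_add, Finset.sum_range_one, hL00] at this
      linarith
    rw [hgiants]
    have := mul_le_mul_of_nonneg_left hlows hy0.le
    nlinarith
  · obtain ⟨J, rfl⟩ : ∃ J, j = J + 1 := ⟨j - 1, by omega⟩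
    exact decAt_gatedShift_succ x q J M μ hx0 hx1 hq0 hq1 (by nlinarith) hμ0 hμM hμ1 hta (by omega) (hS q hq0 hqQ J (by omega))

/-- **`k` sure relays**: `SDECUpTo x Q M μ ⟹ SDECUpTo x Q (k + M) (μ(· − k))` (`k ≥ 1`), by induction on `k` — the shifted law is again a
top-affordable probability law (`shift_laws`). [this work] -/
theorem gatedShift_sdecUpTo (x Q : ℝ) (k M : ℕ) (μ : ℕ → ℝ) (hx0 : 0 < x) (hx1 : x ≤ 1) (hQ1 : Q ≤ 1)
    (hQx : Q * x < 1) (hk : 1 ≤ k) (hμ0 : ∀ h, 0 ≤ μ h) (hμM : ∀ h, M < h → μ h = 0)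
    (hμ1 : ∑ h ∈ Finset.range (M + 1), μ h = 1)
    (hta : x * (M : ℝ) ≤ ∑ h ∈ Finset.range (M + 1), (h : ℝ) * μ h) (hS : SDECUpTo x Q M μ) :
    SDECUpTo x Q (k + M) (fun t => if k ≤ t then μ (t - k) else 0) := by
  induction k with
  | zero => omega
  | succ n ih =>
    rcases Nat.eq_zero_or_pos n with hn | hn
    · subst hn
      rw [show 0 + 1 + M = M + 1 by omega]
      exact gatedShift_sdecUpTo_one x Q M μ hx0 hx1 hQ1 hQx hμ0 hμM hμ1 hta hS
    · have ih' := ih hn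
      obtain ⟨s0, sM, s1, smean⟩ := shift_laws n M μ hμ0 hμM hμ1
      have hta' : x * ((n + M : ℕ) : ℝ) ≤ ∑ t ∈ Finset.range (n + M + 1), (t : ℝ) * (fun t => if n ≤ t then μ (t - n) else 0) t := by
        rw [smean]; push_cast; nlinarith
      have h1 := gatedShift_sdecUpTo_one x Q (n + M) (fun t => if n ≤ t then μ (t - n) else 0) hx0 hx1 hQ1 hQx s0 sM s1 hta' ih'
      have e : (fun t => if 1 ≤ t then (fun t => if n ≤ t then μ (t - n) else 0) (t - 1) else 0)
          = fun t => if n + 1 ≤ t then μ (t - (n + 1)) else 0 := by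
        funext t
        beta_reduce
        by_cases ht : n + 1 ≤ t
        · rw [if_pos ht, if_pos (by omega), if_pos (by omega), show t - 1 - n = t - (n + 1) by omega]
        · rw [if_neg ht]
          by_cases h1 : 1 ≤ t
          · rw [if_pos h1, if_neg (by omega)]
          · rw [if_neg h1]
      rw [e, show n + M + 1 = n + 1 + M by omega] at h1
      exact h1

/-- **CONJECTURE R (`LawDec.GatedShiftDEC`) HOLDS.**  For `0 < x ≤ 1`, `0 < Q ≤ 1`, `Q·x < 1`, `k ≥ 1` and a top-affordable probability law
`μ` on `{0..M}` that is SDEC up to `Q` at `x`, the law `lconv k M δ_k μ = μ(· − k)` is SDEC up to `Q` at `x`: every gate `q ≤ Q` of a root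
vertex carrying `k` sure relays above a forest with law `μ` is DEC at EVERY layer at floor `q·x`. [this work] -/
theorem gatedShiftDEC_holds : GatedShiftDEC := by
  intro x Q k M μ hx0 hx1 _ hQ1 hQx hk hμ0 hμM hμ1 hta hS
  have e : lconv k M (fun i => if i = k then (1 : ℝ) else 0) μ = fun t => if k ≤ t then μ (t - k) else 0 :=
    funext fun t => lconv_point_left k M μ hμM t
  rw [e]
  exact gatedShift_sdecUpTo x Q k M μ hx0 hx1 hQ1 hQx hk hμ0 hμM hμ1 hta hS

end LawDec

end Quant

end Summit.CriticalPhenomena.PercolationContinuityZ3.Theorems
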